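import Summits.Ventures.PercRepro.LawForm

/-!
# PercRepro — C-018 «Z1» and C-019 «Z3»: mine-3's class-positive sharpenings of C-011 (typer-2, gen 5)

`conjectures/CONJECTURES.md` rows C-018 / C-019 (mine-3 (g3) 07:47:45Z; C-ids lead 07:53:28Z; class-positive
on every class of every multigraph with ≤ 9 vertices and ≤ 18 edges, two/three implementations; LISTED with
C-011). Both are inequalities between counts of UNORDERED antipodal pairs `{S, S̄}` of a face cube, read
through the rows of the marked partition of `a, b, c, d` (`rgs4` numbering: `0 = ⊤`, `3, 6, 8 = x_i`
(crossing), `4, 7, 10, 11, 12, 13 = R` (one pair merged: `ab, ac, bc, ad, bd, cd`), `1, 2, 5, 9 = 3|1`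
(singletons `d, c, b, a`), `14 = ⊥`):

* **Z1 (C-018)**: `N(R, 3|1 splitting R's pair) ≥ 2·N(x_i, R_j)` (`i ≠ j`) — the liability pairs of Lemma B⁺
  are dominated two-to-one by the `(R, 3|1)` pairs whose singleton lies in `R`'s merged pair;
* **Z3 (C-019)**: `3·N(⊤,⊥) + N(⊥, x) ≥ 3·N(x_i, x_j) + N(x_i, R_j) + N(R, R′ disjoint pairs) + N(R, 3|1 splitting R)`.

Each ordered pair set below lists every unordered type once (`r31Pairs4`: `R` first; `botCrossPairs4`: `⊥`
first; `disjointAtomPairs4`: the `ab`/`ac`/`ad` atom first), so the `pairCount` sums are the unordered counts,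
exactly as `badCount` / `liabilityCount` in `C011.lean`.

* `blocks4`, `r31Pairs4_spec` / `botCrossPairs4_spec` / `disjointAtomPairs4_spec` (the tables certified against
  `rgs4` by `decide`); `r31Count`, `botCrossCount`, `disjointAtomCount`; **`Z1Class`**, **`Z3Class`** — the class-level statements on
  every face `[v, u]` of every marked multigraph (the form the censuses test);
* `z1Kernel`, `z3Kernel` — the row kernels, `sum_z1Kernel_compl` / `sum_z3Kernel_compl` (antipodal sums);
* **`C018`**, **`C019`** — the law-level rows (`Σ_R π_R Σ_{3|1 splitting R} π_{3|1} ≥ 2·Σ_{i≠j} x_i r_j` and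
  `3·top·bot + bot·Σx ≥ 3e₂(x) + Σ x_i r_j + Σ_{xy|zw} π(xy|z|w)π(x|y|zw) + Σ_R π_R Σ π_{3|1}`);
* **`C018_of_Z1Class`**, **`C019_of_Z3Class`** — class level ⇒ law level (`lawForm_nonneg_of_faces`).
-/

namespace PercRepro

open Finset

/-- The twelve `(R, 3|1)` row pairs in which the singleton of the `3|1` partition lies in the merged pair
of `R` (`R` first; rows by `rgs4`: `4 = ab|c|d`, `7 = ac|b|d`, `10 = a|bc|d`, `11 = ad|b|c`, `12 = a|bd|c`,
`13 = a|b|cd`; `1 = abc|d`, `2 = abd|c`, `5 = acd|b`, `9 = a|bcd`): `ab|c|d` with `a|bcd`, `acd|b`; `ac|b|d`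
with `a|bcd`, `abd|c`; `a|bc|d` with `acd|b`, `abd|c`; `ad|b|c` with `a|bcd`, `abc|d`; `a|bd|c` with `acd|b`,
`abc|d`; `a|b|cd` with `abd|c`, `abc|d`. -/
def r31Pairs4 : Finset (Fin 15 × Fin 15) :=
  {(4, 9), (4, 5), (7, 9), (7, 2), (10, 5), (10, 2), (11, 9), (11, 1), (12, 5), (12, 1), (13, 2), (13, 1)}

/-- The three `(⊥, x_i)` row pairs (`⊥` first). -/
def botCrossPairs4 : Finset (Fin 15 × Fin 15) := {(14, 3), (14, 6), (14, 8)}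

/-- The three `(R, R′)` row pairs with DISJOINT merged pairs (the `ab` / `ac` / `ad` atom first): `ab|c|d` with
`a|b|cd`, `ac|b|d` with `a|bd|c`, `ad|b|c` with `a|bc|d`. -/
def disjointAtomPairs4 : Finset (Fin 15 × Fin 15) := {(4, 13), (7, 12), (11, 10)}

/-- The number of blocks of the engine row `rgs4 s`. -/
def blocks4 (s : Fin 15) : ℕ := (univ.image (rgs4 s)).card

set_option maxRecDepth 8000 in
/-- **The table `r31Pairs4` is what it says** (decided through `rgs4`): in every `(s, t) ∈ r31Pairs4`, `s` has
three blocks, `t` has two, and the singleton index of `t` shares its block in `s` with another index. -/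
theorem r31Pairs4_spec : ∀ q ∈ r31Pairs4, blocks4 q.1 = 3 ∧ blocks4 q.2 = 2 ∧
    ∃ i : Fin 4, (∀ k, k ≠ i → rgs4 q.2 i ≠ rgs4 q.2 k) ∧ ∃ j, j ≠ i ∧ rgs4 q.1 i = rgs4 q.1 j := by
  decide

set_option maxRecDepth 8000 in
/-- **The table `botCrossPairs4` is what it says**: `s = ⊥` (four blocks) and `t` is a crossing partition
(two blocks, every index paired). -/
theorem botCrossPairs4_spec : ∀ q ∈ botCrossPairs4, blocks4 q.1 = 4 ∧ blocks4 q.2 = 2 ∧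
    ∀ i : Fin 4, ∃ j, j ≠ i ∧ rgs4 q.2 i = rgs4 q.2 j := by
  decide

set_option maxRecDepth 8000 in
/-- **The table `disjointAtomPairs4` is what it says**: two three-block rows whose merged pairs are disjoint
(the pair merged in one is split in the other). -/
theorem disjointAtomPairs4_spec : ∀ q ∈ disjointAtomPairs4, blocks4 q.1 = 3 ∧ blocks4 q.2 = 3 ∧
    ∀ i j : Fin 4, i ≠ j → rgs4 q.1 i = rgs4 q.1 j → rgs4 q.2 i ≠ rgs4 q.2 j := by
  decide

section Counts

variable {S : Type*} [Fintype S] [DecidableEq S]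

/-- `N(R, 3|1 splitting R's pair)`: unordered antipodal pairs `{σ, σ̄}` with `f σ = R` and `f σ̄` a `3|1`
partition whose singleton lies in `R`'s merged pair. -/
def r31Count (f : Config S → Fin 15) : ℕ := ∑ q ∈ r31Pairs4, pairCount f q

/-- `N(⊥, x)`: unordered antipodal pairs `{⊥, x_i}`. -/
def botCrossCount (f : Config S → Fin 15) : ℕ := ∑ q ∈ botCrossPairs4, pairCount f q

/-- `N(R, R′ with disjoint pairs)`: unordered antipodal pairs of two atoms with disjoint merged pairs. -/
def disjointAtomCount (f : Config S → Fin 15) : ℕ := ∑ q ∈ disjointAtomPairs4, pairCount f q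

end Counts

/-- **Z1 = C-018 at the class level**: on every face `[v, u]` of the cube of every marked multigraph,
`2·N(x_i, R_j) ≤ N(R, 3|1 splitting R's pair)`. -/
def Z1Class : Prop :=
  ∀ {V E : Type} [Fintype E] [DecidableEq E] (G : MultiGraph V E) (a b c d : V)
    (u v : Config E), v ≤ u →
      2 * liabilityCount
          (fun ρ : Config (Face u v) => row4 (G.markedPartition (embed u v ρ) ![a, b, c, d])) ≤
        r31Count (fun ρ : Config (Face u v) => row4 (G.markedPartition (embed u v ρ) ![a, b, c, d]))

/-- **Z3 = C-019 at the class level**: on every face `[v, u]` of the cube of every marked multigraph,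
`3·N(x_i, x_j) + N(x_i, R_j) + N(R, R′ disjoint) + N(R, 3|1 splitting R) ≤ 3·N(⊤, ⊥) + N(⊥, x)`. -/
def Z3Class : Prop :=
  ∀ {V E : Type} [Fintype E] [DecidableEq E] (G : MultiGraph V E) (a b c d : V)
    (u v : Config E), v ≤ u →
      3 * badCount (fun ρ : Config (Face u v) => row4 (G.markedPartition (embed u v ρ) ![a, b, c, d])) +
          liabilityCount
            (fun ρ : Config (Face u v) => row4 (G.markedPartition (embed u v ρ) ![a, b, c, d])) +
          disjointAtomCount
            (fun ρ : Config (Face u v) => row4 (G.markedPartition (embed u v ρ) ![a, b, c, d])) +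
          r31Count (fun ρ : Config (Face u v) => row4 (G.markedPartition (embed u v ρ) ![a, b, c, d])) ≤
        3 * goodCount (fun ρ : Config (Face u v) => row4 (G.markedPartition (embed u v ρ) ![a, b, c, d])) +
          botCrossCount
            (fun ρ : Config (Face u v) => row4 (G.markedPartition (embed u v ρ) ![a, b, c, d]))

/-! ### The row kernels -/

/-- The indicator kernel of a set of ordered row pairs. -/
def pairKernel (P : Finset (Fin 15 × Fin 15)) (s t : Fin 15) : ℝ :=
  ∑ q ∈ P, if s = q.1 ∧ t = q.2 then 1 else 0

/-- The Z1 row kernel: `[(R, 3|1 splitting R)] − 2·[(x_i, R_j)]`. -/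
def z1Kernel (s t : Fin 15) : ℝ := pairKernel r31Pairs4 s t - 2 * pairKernel liabPairs4 s t

/-- The Z3 row kernel:
`3·[(⊤,⊥)] + [(⊥, x)] − 3·[(x_i, x_j)] − [(x_i, R_j)] − [(R, R′ disjoint)] − [(R, 3|1 splitting R)]`. -/
def z3Kernel (s t : Fin 15) : ℝ :=
  3 * (if s = 0 ∧ t = 14 then 1 else 0) + pairKernel botCrossPairs4 s t - 3 * pairKernel crossPairs4 s t -
    pairKernel liabPairs4 s t - pairKernel disjointAtomPairs4 s t - pairKernel r31Pairs4 s t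

section KernelSums

variable {S : Type*} [Fintype S] [DecidableEq S]

/-- The antipodal sum of an indicator kernel is the pair count of its set. -/
theorem sum_pairKernel_compl (P : Finset (Fin 15 × Fin 15)) (f : Config S → Fin 15) :
    ∑ ρ : Config S, pairKernel P (f ρ) (f ρᶜ) = ∑ q ∈ P, (pairCount f q : ℝ) := by
  simp only [pairKernel, pairCount_eq_sum]
  exact Finset.sum_comm

/-- The antipodal sum of `z1Kernel` is `N(R, 3|1) − 2·N(x, R)`. -/
theorem sum_z1Kernel_compl (f : Config S → Fin 15) :
    ∑ ρ : Config S, z1Kernel (f ρ) (f ρᶜ) = (r31Count f : ℝ) - 2 * liabilityCount f := by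
  simp only [z1Kernel, Finset.sum_sub_distrib, ← Finset.mul_sum, sum_pairKernel_compl, r31Count,
    liabilityCount]
  push_cast
  ring

/-- The antipodal sum of `z3Kernel`. -/
theorem sum_z3Kernel_compl (f : Config S → Fin 15) :
    ∑ ρ : Config S, z3Kernel (f ρ) (f ρᶜ) =
      3 * (goodCount f : ℝ) + botCrossCount f - 3 * badCount f - liabilityCount f -
        disjointAtomCount f - r31Count f := by
  have hg : ∑ ρ : Config S, (if f ρ = 0 ∧ f ρᶜ = 14 then (1 : ℝ) else 0) = goodCount f := by
    rw [goodCount, pairCount_eq_sum]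
  simp only [z3Kernel, Finset.sum_sub_distrib, Finset.sum_add_distrib, ← Finset.mul_sum,
    sum_pairKernel_compl, hg, botCrossCount, badCount, liabilityCount, disjointAtomCount, r31Count]
  push_cast
  ring

end KernelSums

/-! ### The law-level rows -/

/-- **C-018 = Z1 at the law level**: `Σ_R π_R · Σ_{3|1 splitting R's pair} π_{3|1} ≥ 2·Σ_{i≠j} x_i r_j`
for every finite multigraph, every `p ∈ [0,1]^E`, every four marks. -/
def C018 : Prop :=
  ∀ {V E : Type} [Fintype E] [DecidableEq E] (G : MultiGraph V E) (p : E → ℝ), IsProb p →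
    ∀ a b c d : V,
      2 * ∑ q ∈ liabPairs4, G.law4 p a b c d q.1 * G.law4 p a b c d q.2 ≤
        ∑ q ∈ r31Pairs4, G.law4 p a b c d q.1 * G.law4 p a b c d q.2

/-- **C-019 = Z3 at the law level**: `3·top·bot + bot·Σx ≥ 3e₂(x) + Σ_{i≠j} x_i r_j +
Σ_{xy|zw} π(xy|z|w)·π(x|y|zw) + Σ_R π_R·Σ_{3|1 splitting R} π_{3|1}`. -/
def C019 : Prop :=
  ∀ {V E : Type} [Fintype E] [DecidableEq E] (G : MultiGraph V E) (p : E → ℝ), IsProb p →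
    ∀ a b c d : V,
      3 * ∑ q ∈ crossPairs4, G.law4 p a b c d q.1 * G.law4 p a b c d q.2 +
          ∑ q ∈ liabPairs4, G.law4 p a b c d q.1 * G.law4 p a b c d q.2 +
          ∑ q ∈ disjointAtomPairs4, G.law4 p a b c d q.1 * G.law4 p a b c d q.2 +
          ∑ q ∈ r31Pairs4, G.law4 p a b c d q.1 * G.law4 p a b c d q.2 ≤
        3 * (G.law4 p a b c d 0 * G.law4 p a b c d 14) +
          ∑ q ∈ botCrossPairs4, G.law4 p a b c d q.1 * G.law4 p a b c d q.2

/-- The law form of an indicator kernel is the pair sum of the law. -/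
theorem lawForm_pairKernel (π : Fin 15 → ℝ) (P : Finset (Fin 15 × Fin 15)) :
    ∑ s : Fin 15, ∑ t : Fin 15, pairKernel P s t * (π s * π t) = ∑ q ∈ P, π q.1 * π q.2 := by
  simp only [pairKernel, Finset.sum_mul]
  rw [show (∑ s : Fin 15, ∑ t : Fin 15, ∑ q ∈ P, (if s = q.1 ∧ t = q.2 then (1 : ℝ) else 0) * (π s * π t)) =
      ∑ q ∈ P, ∑ s : Fin 15, ∑ t : Fin 15, (if s = q.1 ∧ t = q.2 then (1 : ℝ) else 0) * (π s * π t) from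
    (Finset.sum_congr rfl fun s _ => Finset.sum_comm).trans Finset.sum_comm]
  refine Finset.sum_congr rfl fun q _ => ?_
  have hsplit : ∀ s t : Fin 15, (if s = q.1 ∧ t = q.2 then (1 : ℝ) else 0) =
      (if s = q.1 then (1 : ℝ) else 0) * (if t = q.2 then (1 : ℝ) else 0) := by
    intro s t
    by_cases h1 : s = q.1 <;> by_cases h2 : t = q.2 <;> simp [h1, h2]
  simp only [hsplit, ite_mul, one_mul, zero_mul]
  rw [Finset.sum_comm]
  simp only [Finset.sum_ite_eq', Finset.mem_univ, if_true]

namespace MultiGraph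

variable {V E : Type*} (G : MultiGraph V E) [Fintype E] [DecidableEq E]

/-- **Z1 class-positive on every face ⇒ C-018.** -/
theorem C018_of_Z1Class (h : Z1Class) : C018 := by
  intro V E _ _ G p hp a b c d
  have key := G.lawForm_nonneg_of_faces z1Kernel hp a b c d fun u v hle => by
    rw [sum_z1Kernel_compl]
    have := h G a b c d u v hle
    have h' : (2 * liabilityCount (fun ρ : Config (Face u v) =>
        row4 (G.markedPartition (embed u v ρ) ![a, b, c, d])) : ℝ) ≤
        r31Count (fun ρ : Config (Face u v) => row4 (G.markedPartition (embed u v ρ) ![a, b, c, d])) := by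
      exact_mod_cast this
    linarith
  simp only [z1Kernel, sub_mul, Finset.sum_sub_distrib, mul_assoc, ← Finset.mul_sum,
    lawForm_pairKernel] at key
  linarith

/-- **Z3 class-positive on every face ⇒ C-019.** -/
theorem C019_of_Z3Class (h : Z3Class) : C019 := by
  intro V E _ _ G p hp a b c d
  have key := G.lawForm_nonneg_of_faces z3Kernel hp a b c d fun u v hle => by
    rw [sum_z3Kernel_compl]
    have := h G a b c d u v hle
    have h' : ((3 * badCount (fun ρ : Config (Face u v) =>
          row4 (G.markedPartition (embed u v ρ) ![a, b, c, d])) +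
        liabilityCount (fun ρ : Config (Face u v) =>
          row4 (G.markedPartition (embed u v ρ) ![a, b, c, d])) +
        disjointAtomCount (fun ρ : Config (Face u v) =>
          row4 (G.markedPartition (embed u v ρ) ![a, b, c, d])) +
        r31Count (fun ρ : Config (Face u v) =>
          row4 (G.markedPartition (embed u v ρ) ![a, b, c, d])) : ℕ) : ℝ) ≤
        ((3 * goodCount (fun ρ : Config (Face u v) =>
          row4 (G.markedPartition (embed u v ρ) ![a, b, c, d])) +
        botCrossCount (fun ρ : Config (Face u v) =>
          row4 (G.markedPartition (embed u v ρ) ![a, b, c, d])) : ℕ) : ℝ) := by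
      exact_mod_cast this
    push_cast at h'
    linarith
  have hg : ∑ s : Fin 15, ∑ t : Fin 15, (if s = 0 ∧ t = 14 then (1 : ℝ) else 0) *
      (G.law4 p a b c d s * G.law4 p a b c d t) = G.law4 p a b c d 0 * G.law4 p a b c d 14 := by
    have := lawForm_pairKernel (G.law4 p a b c d) {(0, 14)}
    simpa only [pairKernel, Finset.sum_singleton] using this
  simp only [z3Kernel, add_mul, sub_mul, Finset.sum_add_distrib, Finset.sum_sub_distrib] at key
  simp only [mul_assoc, ← Finset.mul_sum, lawForm_pairKernel] at key
  rw [hg] at key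
  linarith

end MultiGraph

end PercRepro
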